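import Summits.Schanuel.Schanuel.Theorems.DiophantineDichotomyKhovanskiiApproxTypeEvRareFieldDhOfPrimitive
import Summits.Schanuel.Schanuel.Theorems.DiophantineDichotomyKhovanskiiApproxTypeEvRareFieldBalanced
import Summits.Schanuel.Schanuel.Theorems.DiophantineDichotomyKhovanskiiApproxTypeLWPenaltyMeasure
import HarnessLib

/-!
# Line `rare-field-species` — the Lindemann–Weierstrass layer in `(d,h)` currency at EVERY rank
# (`evLWDh`) and its naive shadow on balanced challengers (`evLWBalanced`) — crux
# `KhovanskiiApproxTypeEv` (stmt-Schanuel-14972)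

Route `DiophantineDichotomy` (sub-problem `Schanuel/Schanuel`), line lead
`prover-line-stmt-Schanuel-14972-a4-0`; §3 of the support skeleton
`Cruxes/KhovanskiiApproxTypeEv/Lines/rare_field_species.lean` with its two stubs DISCHARGED:
`stub_dhOfPrimitiveY` (`…RareFieldDhOfPrimitive.lean`) and `stub_balancedOfDhY`
(`…RareFieldBalanced.lean`, p136500); vocabulary `…RareFieldDefs.lean` (p136201).

* `primitiveY_of_lw` — at `s ∈ ℚ̄ⁿ` with `ℚ`-linearly independent coordinates (`n ≥ 1`), the
  primitive approximation measure `PrimitiveApproxMeasureX n (e^s) ((n+1)/n) κ C` on the `y`-half: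
  Ably's codimension-one measure with `μ = n` (`stub_lwPenaltyMeasure`, from the PROVED Literature
  theorem `Ably1994_lindemannWeierstrass_measure_holds`, p121092) through the penalty transfer
  (`stub_penaltyTransfer`, relative Siegel in the challenger's ideal, p85905).  No stub.
* `evLWDh : EvLWDh` (registered goal) — THE ESCAPE HATCH of the card: in `(d,h)` currency the LW
  layer is a THEOREM AT EVERY RANK `n ≥ 1` with the generic exponent `p = 1 + 1/n` (`a = 1/n` in the
  `d^{1+a}` convention of the `(d,h)` re-cut of the crux foreseen by the route's TWO-LAYER PLAN):
  `‖γ − (s, e^s)‖ ≥ exp(−C d^{1+1/n} log H / m)` eventually in `H`, for challengers of level `(d, H)`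
  whose `y`-coordinates have degree `≥ m`.  Unconditional; axioms standard.
* `evLWBalanced : EvLWBalanced` (registered goal) — the NAIVE shadow: at `s ∈ ℚ̄ⁿ` (`n ≥ 2`) and for
  every `x` in the window `1 − 1/(n(n−1)) < x ≤ 1`, the crux's typed bound `exp(−C dᵃ log H)` with
  `a = 1 + 1/n − x < 1/(n−1)` holds eventually in `H` on the challengers all of whose `y`-coordinates
  have degree `≥ dˣ`.  It documents exactly where the naive layer `EvLW n` stops: the complement
  contains the card's rare species (coordinate degree `d^{(n+1)/(2n)}`, below the window for `n ≥ 3`,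
  `species_below_window`).
* `approxTypeEvAt_lw_naive` — the NAIVE consequence (`m = 1`): `ApproxTypeEvAt n s (1 + 1/n) 0 C`, the
  crux's own eventual type with exponent `1 + 1/n` on ALL challengers, unconditional at every LW point
  of every rank `n ≥ 1`, packaged in the crux's own vocabulary `ApproxTypeEvAt` (the crux asks
  `a < 1/(n−1)`; the method-class cap of the card is `(n+1)/(2n)`; this is the full-tuple value).
* window arithmetic `exponent_lt_threshold`, `balanced_window_nonempty`, `species_below_window`.

Nothing here closes or refutes stmt-Schanuel-14972 (the line is a support skeleton by design: the crux
as filed is `⟺ EvNonLWTwo ∧ EvRankThreeUp`, p125111, `⟹ e ⊥ π`, p125943).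
-/

noncomputable section

-- `Summit.Schanuel.Schanuel.…` is the mandated summit/sub-problem namespace (single-conjunct summit), hence:
set_option linter.dupNamespace false

namespace Summit.Schanuel.Schanuel.Cruxes.KhovanskiiApproxTypeEv.RareFieldSpecies

open Summit.Schanuel.Schanuel.Cruxes.KhovanskiiApproxType.LwSmallHeight
  (natDegree_pos_of_aeval_eq_zero)
open Summit.Schanuel.Schanuel.Cruxes.KhovanskiiApproxType.HeightWindowCompactness
  (PrimitiveApproxMeasureX stub_lwPenaltyMeasure stub_penaltyTransfer one_le_of_clause)
open Summit.Schanuel.Schanuel.Cruxes.KhovanskiiApproxTypeEv.AnchoredReduction (ApproxTypeEvAt)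

/-! ## The primitive measure on the `y`-half of an LW point and `EvLWDh` -/

/-- **The primitive approximation measure on the `y`-half of an LW point, every rank** (no stub:
two LANDED theorems): at `s ∈ ℚ̄ⁿ` with `ℚ`-linearly independent coordinates (`n ≥ 1`),
`PrimitiveApproxMeasureX n (e^s) ((n+1)/n) κ C` — Ably's codimension-one measure with `μ = n`
(`stub_lwPenaltyMeasure`, from `Ably1994_lindemannWeierstrass_measure_holds`) through the penalty
transfer (`stub_penaltyTransfer`, `p = (μ+1)/n`). [cite: Ably1994, Théorème p. 30] -/
theorem primitiveY_of_lw (n : ℕ) (s : Fin n → ℂ) (hn : 1 ≤ n) (halg : ∀ i, IsAlgebraic ℚ (s i))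
    (hli : LinearIndependent ℚ s) :
    ∃ κ C : ℝ, PrimitiveApproxMeasureX n (Complex.exp ∘ s) (((n : ℝ) + 1) / n) κ C := by
  obtain ⟨κ, C, hC⟩ := stub_lwPenaltyMeasure n s hn halg hli
  obtain ⟨κ', C', hP⟩ :=
    stub_penaltyTransfer n (Complex.exp ∘ s) ((n : ℕ) : ℝ) κ C hn (Nat.cast_nonneg n) hC
  exact ⟨κ', C', hP⟩

/-- **`EvLWDh` from STUB 2** (the LW layer in `(d,h)` currency at every rank, exponent `1 + 1/n`). -/
theorem evLWDh_of (h₂ : DhOfPrimitiveY) : EvLWDh := by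
  intro n s hn halg hli
  obtain ⟨κ, C, hP⟩ := primitiveY_of_lw n s hn halg hli
  have hn0 : (n : ℝ) ≠ 0 := by exact_mod_cast (show n ≠ 0 by omega)
  have hp : ((n : ℝ) + 1) / n = 1 + 1 / (n : ℝ) := by field_simp
  have hp1 : (1 : ℝ) ≤ ((n : ℝ) + 1) / n := by
    rw [hp]
    have : (0 : ℝ) ≤ 1 / (n : ℝ) := by positivity
    linarith
  obtain ⟨C', hC'⟩ := h₂ n s (((n : ℝ) + 1) / n) κ C hp1 hP
  rw [hp] at hC'
  exact ⟨C', hC'⟩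

/-- The (all-coordinates) `(d,h)` eventual type of a restated crux holds on the LW layer at every
rank `n ≥ 1` with `p = 1 + 1/n`, from STUB 2. -/
theorem approxTypeDhEvAt_lw_of (h₂ : DhOfPrimitiveY) (n : ℕ) (s : Fin n → ℂ) (hn : 1 ≤ n)
    (halg : ∀ i, IsAlgebraic ℚ (s i)) (hli : LinearIndependent ℚ s) :
    ∃ C : ℝ, ApproxTypeDhEvAt n s (1 + 1 / (n : ℝ)) C := by
  obtain ⟨C, hC⟩ := evLWDh_of h₂ n s hn halg hli
  exact ⟨C, approxTypeDhEvAt_of_Y hC⟩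


/-- **`EvLWDh` — the Lindemann–Weierstrass layer in `(d,h)` currency at EVERY rank `n ≥ 1`, exponent
`1 + 1/n`, UNCONDITIONAL** (registered goal of line `rare-field-species`; Ably 1994 + penalty transfer +
threshold bookkeeping `stub_dhOfPrimitiveY`). [cite: Ably1994, Théorème p. 30] -/
theorem evLWDh : EvLWDh :=
  evLWDh_of stub_dhOfPrimitiveY

/-- The (all-coordinates) `(d,h)` eventual type holds on the LW layer at every rank `n ≥ 1` with
`p = 1 + 1/n`, unconditionally. -/
theorem approxTypeDhEvAt_lw (n : ℕ) (s : Fin n → ℂ) (hn : 1 ≤ n) (halg : ∀ i, IsAlgebraic ℚ (s i))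
    (hli : LinearIndependent ℚ s) : ∃ C : ℝ, ApproxTypeDhEvAt n s (1 + 1 / (n : ℝ)) C :=
  approxTypeDhEvAt_lw_of stub_dhOfPrimitiveY n s hn halg hli

/-- **The NAIVE consequence at every rank** (`m = 1`: every algebraic number has degree `≥ 1`): at
`s ∈ ℚ̄ⁿ` with `ℚ`-linearly independent coordinates (`n ≥ 1`) the crux's own eventual type
`ApproxTypeEvAt n s (1 + 1/n) 0 C` holds UNCONDITIONALLY — exponent `1 + 1/n` on ALL challengers
(the full-tuple certificate of the game; at `n = 2` the slot dichotomy does better, `a = 3/4`,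
`stub_evLW_two`; for `n ≥ 3` it packages the landed Ably + transfer measure in the crux's own
vocabulary `ApproxTypeEvAt`, to be compared with the crux's demand `a < 1/(n−1)` and the card's
method-class cap `(n+1)/(2n)`). -/
theorem approxTypeEvAt_lw_naive (n : ℕ) (s : Fin n → ℂ) (hn : 1 ≤ n)
    (halg : ∀ i, IsAlgebraic ℚ (s i)) (hli : LinearIndependent ℚ s) :
    ∃ C : ℝ, ApproxTypeEvAt n s (1 + 1 / (n : ℝ)) 0 C := by
  obtain ⟨C, hC, hall⟩ := evLWDh n s hn halg hli
  refine ⟨C, hC, fun d => ?_⟩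
  obtain ⟨H₀, hH₀⟩ := hall d
  refine ⟨H₀, fun H γ hH hfr hpoly => ?_⟩
  obtain ⟨hd1, hH1⟩ := one_le_of_clause (hpoly (Sum.inl ⟨0, hn⟩))
  have hdeg : ∀ j : Fin n, 1 ≤ (minpoly ℚ (γ (Sum.inr j))).natDegree := fun j => by
    obtain ⟨P, hP0, -, -, hPγ⟩ := hpoly (Sum.inr j)
    exact minpoly.natDegree_pos (natDegree_pos_of_aeval_eq_zero hP0 hPγ).2
  have key := hH₀ H 1 γ hH le_rfl (by exact_mod_cast hd1) hfr hpoly hdeg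
  refine le_trans (Real.exp_le_exp.2 ?_) key
  have hlogH : 0 ≤ Real.log H := Real.log_nonneg hH1
  have hda : 0 ≤ (d : ℝ) ^ (1 + 1 / (n : ℝ)) * Real.log H :=
    mul_nonneg (Real.rpow_nonneg (by positivity) _) hlogH
  rw [Real.rpow_zero, Nat.cast_one, div_one]
  nlinarith

/-! ## The balanced window and `EvLWBalanced` -/

/-- The balanced window is the right one: `1 + 1/n − x < 1/(n−1)` iff `x > 1 − 1/(n(n−1))`. -/
theorem exponent_lt_threshold {n x : ℝ} (hn : 2 ≤ n) (hx : 1 - 1 / (n * (n - 1)) < x) :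
    1 + 1 / n - x < 1 / (n - 1) := by
  have hn0 : n ≠ 0 := (by linarith : (0 : ℝ) < n).ne'
  have hn1 : n - 1 ≠ 0 := (by linarith : (0 : ℝ) < n - 1).ne'
  have key : 1 / n + 1 / (n * (n - 1)) = 1 / (n - 1) := by
    field_simp
    ring
  linarith [key, hx]

/-- The balanced window is non-empty: `1 − 1/(n(n−1)) < 1` for `n ≥ 2`. -/
theorem balanced_window_nonempty {n : ℝ} (hn : 2 ≤ n) : 1 - 1 / (n * (n - 1)) < 1 := by
  have : 0 < 1 / (n * (n - 1)) := by
    apply div_pos one_pos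
    nlinarith
  linarith

/-- The rare species sit OUTSIDE the balanced class: their coordinate degree exponent
`(n+1)/(2n)` is below the window `1 − 1/(n(n−1))` for `n ≥ 3` (at `n = 2` both are `≥ 3/4 > 1/2`:
the species is then inside, consistent with `EvLW 2` being a theorem). -/
theorem species_below_window {n : ℝ} (hn : 3 ≤ n) : (n + 1) / (2 * n) < 1 - 1 / (n * (n - 1)) := by
  have hn0 : 0 < n := by linarith
  have hn1 : 0 < n - 1 := by linarith
  rw [div_lt_iff₀ (by positivity), sub_mul, one_mul, div_mul_eq_mul_div, one_mul,
    div_eq_mul_inv, lt_sub_iff_add_lt]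
  have h2 : 2 * n * (n * (n - 1))⁻¹ = 2 / (n - 1) := by
    field_simp
  rw [h2, ← sub_pos]
  have h3 : 2 * n - (n + 1 + 2 / (n - 1)) = ((n - 1) * (n - 1) - 2) / (n - 1) := by
    field_simp
    ring
  rw [h3]
  apply div_pos _ hn1
  nlinarith

/-- **`EvLWBalanced` from STUBS 2–3** (the naive LW layer on balanced challengers, every rank `≥ 2`,
with `a = 1 + 1/n − x`). -/
theorem evLWBalanced_of (h₂ : DhOfPrimitiveY) (h₃ : BalancedOfDhY) : EvLWBalanced := by
  intro n s x hn halg hli hx _hx1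
  have hn1 : 1 ≤ n := by omega
  obtain ⟨C, hC⟩ := evLWDh_of h₂ n s hn1 halg hli
  refine ⟨1 + 1 / (n : ℝ) - x, C, exponent_lt_threshold (by exact_mod_cast hn) hx, hC.1, ?_⟩
  intro d
  obtain ⟨H₀, hH₀⟩ := h₃ n s (1 + 1 / (n : ℝ)) C x hn1 hC d
  exact ⟨H₀, hH₀⟩


/-- **`EvLWBalanced` — the naive LW layer on balanced challengers at every rank `n ≥ 2`, with
`a = 1 + 1/n − x < 1/(n−1)` for `x` in the window `(1 − 1/(n(n−1)), 1]`, UNCONDITIONAL** (registered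
goal of line `rare-field-species`). -/
theorem evLWBalanced : EvLWBalanced :=
  evLWBalanced_of stub_dhOfPrimitiveY stub_balancedOfDhY

/-! ## The LW layer of the `(d,h)` re-cut, in restatement shape (appended, lead a4) -/

/-- **The Lindemann–Weierstrass layer of the `(d,h)`-currency re-cut of the crux holds at every rank
`n ≥ 2` WITH ROOM**: at `s ∈ ℚ̄ⁿ` with `ℚ`-linearly independent coordinates there are `a < 1/(n−1)`
and `C` with `ApproxTypeDhEvAt n s (1 + a) C` — namely `a = 1/n` (`approxTypeDhEvAt_lw`).  This is
exactly the pointwise conclusion of the restatement input R3 (`KhovanskiiApproxTypeDhEv`-shape: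
`∀ n ≥ 2`, free Khovanskii `s`, `∃ a < 1/(n−1), C, ApproxTypeDhEvAt n s (1 + a) C`) on its LW layer. -/
theorem approxTypeDhEvAt_lw_restated : ∀ (n : ℕ) (s : Fin n → ℂ), 2 ≤ n →
    (∀ i, IsAlgebraic ℚ (s i)) → LinearIndependent ℚ s →
      ∃ a C : ℝ, a < 1 / ((n : ℝ) - 1) ∧ ApproxTypeDhEvAt n s (1 + a) C := by
  intro n s hn halg hli
  obtain ⟨C, hC⟩ := approxTypeDhEvAt_lw n s (by omega) halg hli
  refine ⟨1 / (n : ℝ), C, ?_, hC⟩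
  have h2 : (2 : ℝ) ≤ n := by exact_mod_cast hn
  rw [div_lt_div_iff₀ (by linarith) (by linarith)]
  linarith

end Summit.Schanuel.Schanuel.Cruxes.KhovanskiiApproxTypeEv.RareFieldSpecies

end
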